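import Literature.NumberTheory.Automorphic.UnitBoxPairIntegralAveraging

/-!
# Crux `PairLBoundaryJS` (stmt-Langlands-13622), line `Sketch` — stub `stub_unitBox_translate_avg` (W4b):
# coset averaging of a unit-box pair integrand of product form

Summit `Langlands`, sub-problem `Langlands`, helper file under `Theorems/` supporting the crux
`PairLBoundaryJS` (Arthur–Clozel (1989), Ch. 3, (2.2)), line `Sketch`, registered stub
`stub_unitBox_translate_avg`.

The step of Cogdell (2004), §4.1 ("`Ψ(s; W_φ, W'_{φ'}, Φ) = ∏_v Ψ_v` for factorizable data") in the
tree's unit-box form. A unit-box integrand of PRODUCT form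

  `I(Φ_∞, s)(a, k) = F((diag(a) k)_f) · [A B Φ_∞ |det|^s δ_B⁻¹]((diag(a) k)_∞)`,  `a ∈ 𝕌_Kⁿ⁺¹`,

with `F : GL_{n+1}(𝔸_K^∞) → {0, c}` right `K_f(𝔪)`-invariant on `GL_{n+1}(𝒪̂_K)` and `F(1) = c`, and
`A`, `B` continuous on `GL_{n+1}(K_∞)`, integrates over `B(all finite places) × K` to
`(c r) · ∫ A B Φ_∞ |det|^s δ_B⁻¹ d((νA|.map Θ) × (νK.map π))` with ONE `r > 0` serving every continuous
`Φ_∞` and every `s`. This is `Literature.NumberTheory.Automorphic.setIntegral_unitBox_univ_eq_avg_mul_integral_map`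
(`UnitBoxPairIntegralAveraging`) for the open subgroup `U = K_f(𝔪)`, normal in `GL_{n+1}(𝒪̂_K)`
(`inv_mul_mul_mem_principalCongruenceLevel`): the coset representatives `r_q`, `q ∈ Q`, are chosen once,
`(#Q)⁻¹ Σ_q F(r_q) = c · #{q : F(r_q) ≠ 0} / #Q` because `F ∈ {0, c}`, and `#{q : F(r_q) ≠ 0} ≥ 1` because
`F(r_{q₀}) = F(1 · r_{q₀}) = F(1) = c` (`r_{q₀} ∈ U`). When the archimedean factor is not integrable both
sides vanish (`integrableOn_unitBox_univ_of_productForm`, `integrable_map_prod_map_iff_integrableOn_unitBox`,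
`MeasureTheory.integral_undef`); the pointwise passage `(diag(a) k)_∞ = diag(a_∞) k_∞` is `toMixed_torusPoint`.
When `c = 0` the integrand vanishes on the box and `r = 1` serves.

## References

* J. W. Cogdell, *Analytic theory of L-functions for GL_n*, in *An Introduction to the Langlands
  Program* (2004), §2.3, §4.1 [CogdellAnalyticTheory2004].
* H. Jacquet, J. A. Shalika, *On Euler products and the classification of automorphic
  representations I*, Amer. J. Math. 103 (1981), §4 [JacquetShalikaAJM1981].
-/

noncomputable section

-- `Summit.Langlands.Langlands.…` (summit = sub-problem name, D-0017 layout) trips `dupNamespace`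
set_option linter.dupNamespace false

open scoped MatrixGroups Topology Pointwise ENNReal NNReal ComplexConjugate InnerProductSpace ContDiff
-- the place subtypes indexing `mixedSpace K` are `Fintype` classically (`NormedCommRing (mixedSpace K)`)
open scoped Classical Matrix.Norms.Operator
open NumberField IsDedekindDomain MeasureTheory Measure Matrix Set Filter WithZero
open NumberField.mixedEmbedding
open Literature.NumberTheory.Automorphic AdelicGroupData
open Literature.NumberTheory.GaloisRepresentations (ideleGroup HeckeCharacter)
open ValuativeRel

-- the automorphic quotient carries the tree's Borel σ-algebra, not Mathlib's quotient σ-algebra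
attribute [-instance] Quotient.instMeasurableSpace QuotientGroup.measurableSpace

-- the house local instances, exactly as in `RankinSelbergUnfoldingIdentity`
attribute [local instance] adelicBorel borelSpace_adelic locallyCompactSpace_adelic secondCountableTopology_gl_adelic
  glAdeleBorel borelSpace_glAdele borelSpace_ideleGroup secondCountableTopology_ideleGroup

-- Mathlib idiom: the commutator Lie ring on matrices, to mention `(archGroupGL n K).lie`
attribute [local instance 100] LieRing.ofAssociativeRing

namespace Summit.Langlands.Langlands.Theorems.UnitBoxTranslateAvg

/-- **`K_f(𝔪)` is normal in `GL_n(𝒪̂_K)`**: `g u g⁻¹ ∈ K_f(𝔪)` for `u ∈ K_f(𝔪)` and `g ∈ GL_n(𝒪̂_K)`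
(the tree's `inv_mul_mul_mem_principalCongruenceLevel` at `g⁻¹`). [folklore] -/
theorem mul_mul_inv_mem_finitePrincipalCongruenceLevel {n : ℕ} {K : Type} [Field K] [NumberField K]
    {𝔪 : Ideal (𝓞 K)} {g u : GL (Fin n) (FiniteAdeleRing (𝓞 K) K)}
    (hg : g ∈ glFiniteIntegralLevel n K) (hu : u ∈ finitePrincipalCongruenceLevel n K 𝔪) :
    g * u * g⁻¹ ∈ finitePrincipalCongruenceLevel n K 𝔪 := by
  have h := inv_mul_mul_mem_principalCongruenceLevel (mem_finitePrincipalCongruenceLevel_iff.1 hu)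
    ((glFiniteIntegralLevel n K).inv_mem hg)
  rw [map_inv, inv_inv] at h
  rw [mem_finitePrincipalCongruenceLevel_iff, map_mul, map_mul, map_inv]
  exact h

/-- **The average of a `{0, c}`-valued function over a finite type** is `c · #{q : f q ≠ 0} / #Q`, and the
count is positive as soon as one value is `c ≠ 0`. [folklore] -/
theorem exists_card_sum_eq_of_forall_eq_zero_or_eq {Q : Type} [Fintype Q] {f : Q → ℂ} {c : ℂ}
    (hf : ∀ q, f q = 0 ∨ f q = c) (hc : c ≠ 0) {q₀ : Q} (hq₀ : f q₀ = c) :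
    ∃ m : ℕ, 0 < m ∧ ∑ q, f q = (m : ℂ) * c := by
  refine ⟨(Finset.univ.filter fun q : Q => f q ≠ 0).card, ?_, ?_⟩
  · exact Finset.card_pos.2 ⟨q₀, Finset.mem_filter.2 ⟨Finset.mem_univ _, by rw [hq₀]; exact hc⟩⟩
  · rw [← Finset.sum_filter_ne_zero Finset.univ,
      Finset.sum_congr rfl fun q hq => (hf q).resolve_left (Finset.mem_filter.1 hq).2,
      Finset.sum_const, nsmul_eq_mul]

/-- **Coset averaging of a unit-box integrand of product form** (registered stub `stub_unitBox_translate_avg`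
of the crux `PairLBoundaryJS`, line `Sketch`). A unit-box integrand of product form
`F((diag a k)_f) · A B Φ_∞ |det|^s δ⁻¹((diag a k)_∞)` with `F : GL_{n+1}(𝔸_K^∞) → {0, c}` right
`K_f(𝔪)`-invariant on `GL_{n+1}(𝒪̂)` and `F(1) = c` integrates to `(c r) ·` the archimedean integral of
`A B Φ_∞ |det|^s δ⁻¹` for the image Haar measures, with ONE `r > 0` for all continuous `Φ_∞` and all `s`
(`setIntegral_unitBox_univ_eq_avg_mul_integral_map` with `U = K_f(𝔪)`, normal in `GL_{n+1}(𝒪̂)`; the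
representatives are chosen once; `r = #{q : F(r_q) ≠ 0} / #Q`; when the archimedean factor is not integrable
both sides vanish: `integrableOn_unitBox_univ_of_productForm`, `integrable_map_prod_map_iff_integrableOn_unitBox`;
`toMixed_torusPoint`). [cite: CogdellAnalyticTheory2004, §4.1] -/
theorem stub_unitBox_translate_avg :
    ∀ {n : ℕ} {K : Type} [Field K] [NumberField K]
      [MeasurableSpace (AdeleRing (𝓞 K) K)] [BorelSpace (AdeleRing (𝓞 K) K)]
      [MeasurableSpace (GL (Fin (n + 1)) (mixedSpace K))] [BorelSpace (GL (Fin (n + 1)) (mixedSpace K))]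
      (hcpt : isCompact_glFiniteIntegralLevel (n + 1) K)
      (νA : Measure (Fin (n + 1) → ideleGroup K)) [IsHaarMeasure νA]
      (νK : Measure ↥(maximalCompactAdelic (n + 1) K)) [IsHaarMeasure νK]
      {𝔪 : Ideal (𝓞 K)} (_ : 𝔪 ≠ 0) (F : GL (Fin (n + 1)) (FiniteAdeleRing (𝓞 K) K) → ℂ)
      (_ : ∀ g ∈ glFiniteIntegralLevel (n + 1) K, ∀ u ∈ finitePrincipalCongruenceLevel (n + 1) K 𝔪, F (g * u) = F g)
      (c : ℂ) (_ : ∀ g, F g = 0 ∨ F g = c) (_ : F 1 = c)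
      (A B : GL (Fin (n + 1)) (mixedSpace K) → ℂ) (_ : Continuous A) (_ : Continuous B)
      (I : ((Fin (n + 1) → InfiniteAdeleRing K) → ℝ) → ℂ → (Fin (n + 1) → ideleGroup K) × ↥(maximalCompactAdelic (n + 1) K) → ℂ)
      (_ : ∀ (Φinf : (Fin (n + 1) → InfiniteAdeleRing K) → ℝ) (s : ℂ)
        (p : (Fin (n + 1) → ideleGroup K) × ↥(maximalCompactAdelic (n + 1) K)),
        p.1 ∈ unitBox (n := n + 1) (K := K) (Set.univ : Set (HeightOneSpectrum (𝓞 K))) →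
        I Φinf s p = F (GLn.sndHom (n + 1) K (torusPoint (n + 1) K p)) *
          (A (GLn.toMixed (n + 1) K (torusPoint (n + 1) K p)) * B (GLn.toMixed (n + 1) K (torusPoint (n + 1) K p)) *
            ((Φinf (archLastRow (n + 1) K (GLn.toMixed (n + 1) K (torusPoint (n + 1) K p))) : ℝ) : ℂ) *
            archTorusWeightC (n + 1) K s (archTorusOfIdele (n + 1) K p.1))),
    ∃ r : ℝ, 0 < r ∧ ∀ (Φinf : (Fin (n + 1) → InfiniteAdeleRing K) → ℝ), Continuous Φinf → ∀ s : ℂ,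
      ∫ p in unitBox (Set.univ : Set (HeightOneSpectrum (𝓞 K))) ×ˢ Set.univ, I Φinf s p ∂(νA.prod νK) =
        (c * r) * ∫ z : (Fin (n + 1) → (mixedSpace K)ˣ) × ↥(Kinf (n + 1) K), A (glDiagonal (n + 1) (mixedSpace K) z.1 * (z.2 : GL (Fin (n + 1)) (mixedSpace K))) * B (glDiagonal (n + 1) (mixedSpace K) z.1 * (z.2 : GL (Fin (n + 1)) (mixedSpace K))) *
            ((Φinf (archLastRow (n + 1) K (glDiagonal (n + 1) (mixedSpace K) z.1 * (z.2 : GL (Fin (n + 1)) (mixedSpace K)))) : ℝ) : ℂ) * archTorusWeightC (n + 1) K s z.1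
          ∂(((νA.restrict (unitBox (Set.univ : Set (HeightOneSpectrum (𝓞 K))))).map
            (archTorusOfIdele (n + 1) K)).prod (νK.map (kinfOfMaximalCompact (n + 1) K))) := by
  intro n K _ _ _ _ _ _ hcpt νA _ νK _ 𝔪 h𝔪 F hF c hFc hF1 A B hA hB I hI
  -- Haar measures: `νA` is σ-finite, `νK` is finite (`K` is compact)
  haveI := locallyCompactSpace_ideleGroup K
  haveI : SigmaFinite νA := inferInstance
  haveI : CompactSpace ↥(maximalCompactAdelic (n + 1) K) :=
    isCompact_iff_compactSpace.1 (isCompact_maximalCompactAdelic (n + 1) K)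
  haveI : IsFiniteMeasure νK := inferInstance
  -- the open subgroup `U = K_f(𝔪)`, normalised by `GL_{n+1}(𝒪̂_K)`
  have hUo : IsOpen ((finitePrincipalCongruenceLevel (n + 1) K 𝔪 :
      Subgroup (GL (Fin (n + 1)) (FiniteAdeleRing (𝓞 K) K))) : Set (GL (Fin (n + 1)) (FiniteAdeleRing (𝓞 K) K))) :=
    isOpen_finitePrincipalCongruenceLevel (n + 1) K h𝔪
  have hUn : ∀ g ∈ glFiniteIntegralLevel (n + 1) K, ∀ u ∈ finitePrincipalCongruenceLevel (n + 1) K 𝔪,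
      g * u * g⁻¹ ∈ finitePrincipalCongruenceLevel (n + 1) K 𝔪 := fun g hg u hu =>
    mul_mul_inv_mem_finitePrincipalCongruenceLevel hg hu
  -- the coset representatives `r q`, chosen ONCE (independently of `Φ_∞` and `s`)
  obtain ⟨Q, _, r, q₀, hq₀, -, hmain⟩ :=
    setIntegral_unitBox_univ_eq_avg_mul_integral_map hcpt νA νK hUo hUn
  have hboxm : MeasurableSet (unitBox (n := n + 1) (K := K) (Set.univ : Set (HeightOneSpectrum (𝓞 K))) ×ˢ
      (Set.univ : Set ↥(maximalCompactAdelic (n + 1) K))) :=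
    (measurableSet_unitBox _).prod MeasurableSet.univ
  by_cases hc : c = 0
  · -- `F ≡ 0`: the integrand vanishes on the box, both sides are `0`, `r = 1` serves
    refine ⟨1, one_pos, fun Φinf _ s => ?_⟩
    have hF0 : ∀ g, F g = 0 := fun g => (hFc g).elim id fun h => h.trans hc
    have hI0 : ∀ p ∈ unitBox (n := n + 1) (K := K) (Set.univ : Set (HeightOneSpectrum (𝓞 K))) ×ˢ
        (Set.univ : Set ↥(maximalCompactAdelic (n + 1) K)), I Φinf s p = 0 := by
      rintro p ⟨hp, -⟩
      rw [hI Φinf s p hp, hF0, zero_mul]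
    rw [setIntegral_congr_fun hboxm hI0, integral_zero, hc, zero_mul, zero_mul]
  · -- `c ≠ 0`: `F(r q₀) = F(1 · r q₀) = F 1 = c`, so `m = #{q : F(r q) ≠ 0} ≥ 1`
    have hrq₀ : F (r q₀) = c := by
      have h := hF 1 (glFiniteIntegralLevel (n + 1) K).one_mem (r q₀) hq₀
      rw [one_mul] at h
      rw [h, hF1]
    obtain ⟨m, hm, hsum⟩ := exists_card_sum_eq_of_forall_eq_zero_or_eq (f := fun q => F (r q)) (fun q => hFc (r q))
      hc hrq₀
    have hQ : 0 < Fintype.card Q := Fintype.card_pos_iff.2 ⟨q₀⟩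
    have havg : (Fintype.card Q : ℂ)⁻¹ * ∑ q, F (r q) = c * (((m : ℝ) / (Fintype.card Q : ℝ) : ℝ) : ℂ) := by
      rw [hsum]
      push_cast
      ring
    have hF1' : F 1 ≠ 0 := by
      rw [hF1]
      exact hc
    refine ⟨(m : ℝ) / (Fintype.card Q : ℝ), div_pos (Nat.cast_pos.2 hm) (Nat.cast_pos.2 hQ), fun Φinf hΦ s => ?_⟩
    -- the archimedean factor `Γ = A B Φ_∞ |det|^s δ⁻¹` in the coordinates `(y, k) ↦ diag(y) k`
    set Γ : (Fin (n + 1) → (mixedSpace K)ˣ) × ↥(Kinf (n + 1) K) → ℂ := fun z =>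
      A (glDiagonal (n + 1) (mixedSpace K) z.1 * (z.2 : GL (Fin (n + 1)) (mixedSpace K))) *
        B (glDiagonal (n + 1) (mixedSpace K) z.1 * (z.2 : GL (Fin (n + 1)) (mixedSpace K))) *
        ((Φinf (archLastRow (n + 1) K (glDiagonal (n + 1) (mixedSpace K) z.1 *
          (z.2 : GL (Fin (n + 1)) (mixedSpace K)))) : ℝ) : ℂ) * archTorusWeightC (n + 1) K s z.1 with hΓ_def
    have hΓc : Continuous Γ :=
      (((hA.comp continuous_glDiagonal_mul_kinf).mul (hB.comp continuous_glDiagonal_mul_kinf)).mul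
        (Complex.continuous_ofReal.comp (hΦ.comp (continuous_archLastRow.comp continuous_glDiagonal_mul_kinf)))).mul
        ((continuous_archTorusWeightC s).comp continuous_fst)
    -- the product form `I = F((diag a k)_f) · Γ(a_∞, k_∞)` on the box (`toMixed_torusPoint`)
    have hIΓ : ∀ p : (Fin (n + 1) → ideleGroup K) × ↥(maximalCompactAdelic (n + 1) K),
        p.1 ∈ unitBox (n := n + 1) (K := K) (Set.univ : Set (HeightOneSpectrum (𝓞 K))) →
          I Φinf s p = F (GLn.sndHom (n + 1) K (torusPoint (n + 1) K p)) *
            Γ (archTorusOfIdele (n + 1) K p.1, kinfOfMaximalCompact (n + 1) K p.2) := by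
      rintro ⟨a, k⟩ hp
      rw [hI Φinf s (a, k) hp, hΓ_def]
      dsimp only
      rw [toMixed_torusPoint]
    by_cases hint : IntegrableOn (fun p : (Fin (n + 1) → ideleGroup K) × ↥(maximalCompactAdelic (n + 1) K) =>
        Γ (archTorusOfIdele (n + 1) K p.1, kinfOfMaximalCompact (n + 1) K p.2))
        (unitBox (Set.univ : Set (HeightOneSpectrum (𝓞 K))) ×ˢ Set.univ) (νA.prod νK)
    · -- integrable archimedean factor: the averaging theorem
      rw [hmain F hF hΓc hint (I Φinf s) hIΓ, havg]
    · -- not integrable: both Bochner integrals vanish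
      have hnI : ¬ IntegrableOn (I Φinf s)
          (unitBox (Set.univ : Set (HeightOneSpectrum (𝓞 K))) ×ˢ Set.univ) (νA.prod νK) := fun h =>
        hint (integrableOn_unitBox_univ_of_productForm hcpt νA νK hUo hUn F hF hF1' hΓc (I Φinf s) hIΓ h)
      have hnΓ : ¬ Integrable Γ (((νA.restrict (unitBox (Set.univ : Set (HeightOneSpectrum (𝓞 K))))).map
          (archTorusOfIdele (n + 1) K)).prod (νK.map (kinfOfMaximalCompact (n + 1) K))) := fun h =>
        hint ((integrable_map_prod_map_iff_integrableOn_unitBox νA νK hΓc).1 h)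
      rw [integral_undef hnI, integral_undef hnΓ, mul_zero]

end Summit.Langlands.Langlands.Theorems.UnitBoxTranslateAvg
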